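import Summits.BirchSwinnertonDyer.Rank1Residual.Additive.AdditiveOrdinaryLowerHalf
import Summits.BirchSwinnertonDyer.Rank1Residual.Additive.X3BranchGordEndStateIntrinsic
import Summits.BirchSwinnertonDyer.Rank1Residual.Additive.N10IsogenyTransport
import HarnessLib

/-!
# Rung K1 (`AdditiveBranchIMC`): the leaf `AdditiveOrdinaryLowerHalf` from its inputs, BY NAME

Theorems-side bridge for the ledger route `AdditiveBranchIMC` (D-0059 / D-0061; cell `bsd-addord`,
`run/shared/lean/pub/bsd-addord/TARGET.md` v6.7 §(routes) / v6.8 L4.54; director-bsd INBOX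
2026-08-25T19:23:15Z: route files may import only `Literature`, `HarnessLib`, the Statement and
`Theorems/*`, while the rung-K1 leaf
`Summit.BirchSwinnertonDyer.Rank1Residual.Additive.AdditiveOrdinaryLowerHalf` (= `N10.LowerHalf ∧ O7.LowerHalf`:
the LOWER half `MissingLowerBoundAt W p` — `ord_p #Ш ≥ ord_p Ш_an` — on the additive potentially-ordinary
locus `N10.Locus W p` in analytic rank `≤ 1`) and its vocabulary (`N10.CellM / CellGordTwo / CellGordHigher`,
`HasCaseOneMember`) live under `Summits/BirchSwinnertonDyer/Rank1Residual/Additive/`. This module imports the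
leaf (and, for the route's `PubInputs` constants and the provers who will close `X3CaseOneRankZero`, the
intrinsic end states `X3BranchGordEndStateIntrinsic` and `N10IsogenyTransport`) and proves, once, the kernel certificate the route's deciding theorem applies:

* `additiveOrdinaryLowerHalf_of_inputs` — the leaf follows from FIVE inputs spelled INLINE as hypotheses
  (they are, definitionally, the route's items): the support `X3CaseOneRankZero` in consequent form
  (`hX3`: cell (G-ord, `e = 2`), analytic rank `0`, the isogeny class has a Case-1 member — exactly the
  cell's 824 booked bx3g rows, closed by the intrinsic end states `ClassX3Gord.missingLowerBoundAt[_three]_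
  rankZero_of_facts_intrinsic` plus isogeny transport, modulo the route's `PubInputs`), and the four open
  cruxes `GordTwoRankZeroOffCaseOne` (`h2`), `GordTwoRankOne` (`h3`), `MultLower` (`h4`),
  `GordHigherLower` (`h5`, declared residual); by `N10.locus_iff_cells`, `Nat.le_one_iff_eq_zero_or_eq_one`
  and excluded middle on `HasCaseOneMember W p`.
* `x3CaseOneRankZero_of_facts` — the support item PROVED from the named facts (p404507's intrinsic end
  states at `p = 3` / `p ≥ 5` ∘ Cassels transport `N10.missingLowerBoundAt_of_isIsogenous_of_bsdp`).
* `additiveOrdinaryLowerHalf_of_facts_of_inputs` — the leaf from the named facts and the four open cruxes.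
Nothing is asserted: every input is a hypothesis by name. [cite: GreenbergVatsal2000, Thm 3.12]
[cite: Delbourgo1998, Prop 4] [cite: Wuthrich2014, Thm 16]
-/

set_option autoImplicit false
set_option linter.dupNamespace false

noncomputable section

open scoped Classical

open WeierstrassCurve Literature.NumberTheory.EllipticCurves
  Literature.NumberTheory.EllipticCurves.Rank1Residual
  Literature.NumberTheory.EllipticCurves.Rank1Residual.Typed

namespace Summit.BirchSwinnertonDyer.BirchSwinnertonDyer.Theorems.AdditiveBranchIMCInputs

open Summit.BirchSwinnertonDyer.Rank1Residual.Additive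
open Literature.NumberTheory.EllipticCurves.ModularForms Literature.NumberTheory.EllipticCurves.GreenbergVatsal2000
  Literature.NumberTheory.GaloisRepresentations IsDedekindDomain NumberField

/-- **Rung K1 from its inputs.** [cite: GreenbergVatsal2000, Thm 3.12] -/
theorem additiveOrdinaryLowerHalf_of_inputs
    (hX3 : ∀ (W : WeierstrassCurve ℚ) [W.IsElliptic] [W.IsGloballyMinimal] (p : ℕ) [Fact p.Prime],
      W.analyticRank = 0 → N10.CellGordTwo W p → HasCaseOneMember W p → MissingLowerBoundAt W p)
    (h2 : ∀ (W : WeierstrassCurve ℚ) [W.IsElliptic] [W.IsGloballyMinimal] (p : ℕ) [Fact p.Prime],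
      W.analyticRank = 0 → N10.CellGordTwo W p → ¬ HasCaseOneMember W p → MissingLowerBoundAt W p)
    (h3 : ∀ (W : WeierstrassCurve ℚ) [W.IsElliptic] [W.IsGloballyMinimal] (p : ℕ) [Fact p.Prime],
      W.analyticRank = 1 → N10.CellGordTwo W p → MissingLowerBoundAt W p)
    (h4 : ∀ (W : WeierstrassCurve ℚ) [W.IsElliptic] [W.IsGloballyMinimal] (p : ℕ) [Fact p.Prime],
      W.analyticRank ≤ 1 → N10.CellM W p → MissingLowerBoundAt W p)
    (h5 : ∀ (W : WeierstrassCurve ℚ) [W.IsElliptic] [W.IsGloballyMinimal] (p : ℕ) [Fact p.Prime],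
      W.analyticRank ≤ 1 → N10.CellGordHigher W p → MissingLowerBoundAt W p) :
    AdditiveOrdinaryLowerHalf := by
  intro W _ _ p _ hr hL
  rcases (N10.locus_iff_cells W p).mp hL with hc | hc | hc
  · exact h4 W p hr hc
  · rcases Nat.le_one_iff_eq_zero_or_eq_one.mp hr with h0 | h1
    · by_cases hm : HasCaseOneMember W p
      · exact hX3 W p h0 hc hm
      · exact h2 W p h0 hc hm
    · exact h3 W p h1 hc
  · exact h5 W p hr hc

/-- **The support item `X3CaseOneRankZero` of route `AdditiveBranchIMC`, proved from the named facts**: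
on cell (G-ord, `e = 2`) in analytic rank `0`, every curve whose isogeny class has a Case-1 member gets
the lower half `MissingLowerBoundAt W p` — at `p = 3` from the kernel record `X3LineDatumThree W'` via
`ClassX3Gord.bsdp_three_rankZero_of_facts_of_lineDatum_intrinsic`, at `p ≥ 5` from the line datum via
`ClassX3Gord.bsdp_rankZero_of_facts_intrinsic`, then Cassels transport
`N10.missingLowerBoundAt_of_isIsogenous_of_bsdp` (the cell's 824 booked rank-0 rows as ONE statement;
facts split as the route splits them: PRINTED `h23 h414 hGrK hDel98 hGZK hmod hmodD hCassels`, READING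
`hW16 hGV hLiftF hLiftE hDelG`). [cite: GreenbergVatsal2000, Thm 3.12] [cite: Delbourgo1998, Prop 4]
[cite: MilneADT2006, Thm I.7.3] -/
theorem x3CaseOneRankZero_of_facts
    (h23 : datumSelmer_nonPrimitive_invariants)
    (h414 : Greenberg1999.prop414_noFiniteSubmodule_of_not_dvd_torsionOrder)
    (hGrK : Greenberg1999.imKummer_ge_strictCondition_goodOrdinary)
    (hDel98 : Delbourgo1998.prop4_rankZero_pow_dvd_constantCoeff)
    (hGZK : rank_eq_analyticRank_of_analyticRank_le_one) (hmod : hasEntireLFunction_rat)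
    (hmodD : nonempty_modularParametrizationData) (hCassels : bsdRHS_eq_of_isIsogenous)
    (hW16 : Wuthrich2014.thm16_halfEigenCharIdeal_dvd_cyclotomicPrime)
    (hGV : thm312_branch_unitContent_and_lambda_eq_residual_goodOrd)
    (hLiftF : residualEpsilon_surjOn_of_lineRamifiedEven)
    (hLiftE : residualEpsilon_surjOn_of_lineEven)
    (hDelG : Delbourgo1998.prop4_rankZero_constantCoeff_eq_unit_mul_of_potGoodOrd) :
    ∀ (W : WeierstrassCurve ℚ) [W.IsElliptic] [W.IsGloballyMinimal] (p : ℕ) [Fact p.Prime],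
      W.analyticRank = 0 → N10.CellGordTwo W p → HasCaseOneMember W p → MissingLowerBoundAt W p := by
  intro W _ _ p _ hr _hcell hmem
  obtain ⟨W', hE', hM', hiso, hX', he', hdat⟩ := hmem
  haveI := hE'
  haveI := hM'
  have hr' : W'.analyticRank = 0 := by rw [← analyticRank_eq_of_isIsogenous' hiso]; exact hr
  have hle : W.analyticRank ≤ 1 := by rw [hr]; exact zero_le_one
  rcases hdat with ⟨hp3, hL⟩ | ⟨hp5, Φ₀, hΦ, hram0, heven, hram⟩
  · subst hp3
    exact N10.missingLowerBoundAt_of_isIsogenous_of_bsdp 3 hCassels hGZK hmod hiso hle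
      (ClassX3Gord.bsdp_three_rankZero_of_facts_of_lineDatum_intrinsic hW16 hGV h23 h414 hGrK hLiftE hDelG
        hDel98 hGZK hmod hmodD hX' hr' hL)
  · exact N10.missingLowerBoundAt_of_isIsogenous_of_bsdp p hCassels hGZK hmod hiso hle
      (ClassX3Gord.bsdp_rankZero_of_facts_intrinsic hW16 hGV h23 h414 hGrK hLiftF hDelG hDel98 hGZK hmod
        hmodD hX' hp5 he' hr' Φ₀ hΦ hram0 heven hram)


/-- **Rung K1 from the named facts and the four open cruxes** (`additiveOrdinaryLowerHalf_of_inputs` ∘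
`x3CaseOneRankZero_of_facts`): the form a closing theorem of the route uses once items 2–5 are proved.
[cite: GreenbergVatsal2000, Thm 3.12] [cite: MilneADT2006, Thm I.7.3] -/
theorem additiveOrdinaryLowerHalf_of_facts_of_inputs
    (h23 : datumSelmer_nonPrimitive_invariants)
    (h414 : Greenberg1999.prop414_noFiniteSubmodule_of_not_dvd_torsionOrder)
    (hGrK : Greenberg1999.imKummer_ge_strictCondition_goodOrdinary)
    (hDel98 : Delbourgo1998.prop4_rankZero_pow_dvd_constantCoeff)
    (hGZK : rank_eq_analyticRank_of_analyticRank_le_one) (hmod : hasEntireLFunction_rat)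
    (hmodD : nonempty_modularParametrizationData) (hCassels : bsdRHS_eq_of_isIsogenous)
    (hW16 : Wuthrich2014.thm16_halfEigenCharIdeal_dvd_cyclotomicPrime)
    (hGV : thm312_branch_unitContent_and_lambda_eq_residual_goodOrd)
    (hLiftF : residualEpsilon_surjOn_of_lineRamifiedEven)
    (hLiftE : residualEpsilon_surjOn_of_lineEven)
    (hDelG : Delbourgo1998.prop4_rankZero_constantCoeff_eq_unit_mul_of_potGoodOrd)
    (h2 : ∀ (W : WeierstrassCurve ℚ) [W.IsElliptic] [W.IsGloballyMinimal] (p : ℕ) [Fact p.Prime],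
      W.analyticRank = 0 → N10.CellGordTwo W p → ¬ HasCaseOneMember W p → MissingLowerBoundAt W p)
    (h3 : ∀ (W : WeierstrassCurve ℚ) [W.IsElliptic] [W.IsGloballyMinimal] (p : ℕ) [Fact p.Prime],
      W.analyticRank = 1 → N10.CellGordTwo W p → MissingLowerBoundAt W p)
    (h4 : ∀ (W : WeierstrassCurve ℚ) [W.IsElliptic] [W.IsGloballyMinimal] (p : ℕ) [Fact p.Prime],
      W.analyticRank ≤ 1 → N10.CellM W p → MissingLowerBoundAt W p)
    (h5 : ∀ (W : WeierstrassCurve ℚ) [W.IsElliptic] [W.IsGloballyMinimal] (p : ℕ) [Fact p.Prime],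
      W.analyticRank ≤ 1 → N10.CellGordHigher W p → MissingLowerBoundAt W p) :
    AdditiveOrdinaryLowerHalf :=
  additiveOrdinaryLowerHalf_of_inputs
    (x3CaseOneRankZero_of_facts h23 h414 hGrK hDel98 hGZK hmod hmodD hCassels hW16 hGV hLiftF hLiftE hDelG)
    h2 h3 h4 h5

end Summit.BirchSwinnertonDyer.BirchSwinnertonDyer.Theorems.AdditiveBranchIMCInputs

end
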